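import Mathlib
import HarnessLib

/-!
# Route `KLProgramme` — crux K3, ENGINE child gen 5 (stmt-HubbardSuperconductivity-19918 `KLRegimeEngineV14`), stub `stub_engine_step_values`,
# conjunct (E2-v9) at `1 ≤ n`: the a priori bound WITHIN a slice by bootstrap from the flow — `kltc_apriori_of_flow`

Cell gate-hubbard-kl, seat hubbard-kl-k3c1-p1 (g6), technique «composed-map remainder propagation».  The weighted Duhamel comparison
(`kltc_riccati_duhamel_weighted`, p500198) and its model instance (`klws_wickStep_of_scaleFlow`, p505675) take an A PRIORI entry bound
`|Γ(t)| ≤ m` along the whole slice `t ∈ [0,1]`, while the engine's history only bounds the running values at the END POINTS (the scale grid).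
Within a slice the bound PROPAGATES from the flow itself: if a finite family of quantities `f t k` (the running pair kernel at all labels, or all
quartic/sextic kernels the source reads) starts at `‖f 0 k‖ ≤ m₀`, and its rate is controlled CONDITIONALLY — «whenever every tracked quantity is
`≤ m` at time `t`, every rate is `≤ g t`» (the shape the two-vertex source bound has: it reads the running action at the same scale only) —
and the budget has slack `m₀ + ∫₀¹ g < m`, then `‖f t k‖ ≤ m₀ + ∫₀ᵗ g ≤ m` on all of `[0,1]` (continuous induction = Mathlib's fencing lemma
`image_norm_le_of_norm_deriv_right_lt_deriv_boundary` in the sup norm of the finite family).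

* `kltc_apriori_of_flow` (family form, conclusion `≤ m₀ + ∫₀ᵗ g`), `kltc_apriori_of_flow_le` (`≤ m`),
* `kltc_apriori_matrix_of_flow` (matrix entries `Γ t x y`, the `hΓm` input of `kltc_riccati_duhamel_weighted` / `klws_wickStep_of_scaleFlow`).

Real analysis only; nothing about the model is asserted.  0 kit.
-/

noncomputable section

namespace Summit.HubbardSuperconductivity.HubbardSuperconductivity.Theorems.KLRegimeSplit

set_option linter.dupNamespace false -- summit = problem name (single-conjunct summit), D-0017

open Set MeasureTheory intervalIntegral

section Generic

variable {κ : Type*} [Fintype κ]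

/-- **A priori bound within a slice by bootstrap from the flow.**  `f, ḟ : ℝ → κ → ℂ` a finite family of C¹ quantities on `[0,1]`
(`HasDerivAt (f · k) (ḟ t k) t`), `g ≥ 0` continuous on `[0,1]`, start `‖f 0 k‖ ≤ m₀` (`0 ≤ m₀`), CONDITIONAL rate
`(∀ k, ‖f t k‖ ≤ m) → ∀ k, ‖ḟ t k‖ ≤ g t` for `t ∈ [0,1)`, slack `m₀ + ∫₀¹ g < m`.  THEN `‖f t k‖ ≤ m₀ + ∫₀ᵗ g` for all `t ∈ [0,1]`, all `k`. -/
theorem kltc_apriori_of_flow (f f' : ℝ → κ → ℂ) (g : ℝ → ℝ) {m m₀ : ℝ} (hm₀ : 0 ≤ m₀)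
    (hf : ∀ t ∈ Icc (0 : ℝ) 1, ∀ k, HasDerivAt (fun s => f s k) (f' t k) t)
    (hg : ContinuousOn g (Icc 0 1)) (hg0 : ∀ t ∈ Icc (0 : ℝ) 1, 0 ≤ g t) (h0 : ∀ k, ‖f 0 k‖ ≤ m₀)
    (hrate : ∀ t ∈ Ico (0 : ℝ) 1, (∀ k, ‖f t k‖ ≤ m) → ∀ k, ‖f' t k‖ ≤ g t)
    (hslack : m₀ + ∫ t in (0 : ℝ)..1, g t < m) :
    ∀ t ∈ Icc (0 : ℝ) 1, ∀ k, ‖f t k‖ ≤ m₀ + ∫ s in (0 : ℝ)..t, g s := by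
  -- clamp-and-extend `g` to a continuous function on `ℝ`
  set cl : ℝ → ℝ := fun t => max 0 (min t 1) with hcl
  have hclamp : ∀ t, cl t ∈ Icc (0 : ℝ) 1 := fun t => ⟨le_max_left _ _, max_le zero_le_one (min_le_right _ _)⟩
  have hclc : Continuous cl := continuous_const.max (continuous_id.min continuous_const)
  set G : ℝ → ℝ := g ∘ cl with hG
  have hGc : Continuous G := hg.comp_continuous hclc hclamp
  have hGg : ∀ t ∈ Icc (0 : ℝ) 1, G t = g t := fun t ht => by
    simp only [hG, hcl, Function.comp_apply, min_eq_left ht.2, max_eq_right ht.1]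
  have hG0 : ∀ t, 0 ≤ G t := fun t => hg0 _ (hclamp t)
  have hint : ∀ x ∈ Icc (0 : ℝ) 1, ∫ s in (0 : ℝ)..x, G s = ∫ s in (0 : ℝ)..x, g s := fun x hx =>
    integral_congr fun s hs => hGg s (by
      rw [uIcc_of_le hx.1] at hs
      exact ⟨hs.1, hs.2.trans hx.2⟩)
  set I1 : ℝ := ∫ t in (0 : ℝ)..1, g t with hI1
  have hε : 0 < m - (m₀ + I1) := sub_pos.2 hslack
  have hIle : ∀ x ∈ Icc (0 : ℝ) 1, ∫ s in (0 : ℝ)..x, G s ≤ I1 := fun x hx => by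
    rw [hI1, ← hint 1 ⟨zero_le_one, le_rfl⟩]
    exact integral_mono_interval le_rfl hx.1 hx.2 (ae_of_all _ hG0) (hGc.intervalIntegrable 0 1)
  -- the curve in the sup-normed space `κ → ℂ`
  have hF : ∀ t ∈ Icc (0 : ℝ) 1, HasDerivAt f (f' t) t := fun t ht => hasDerivAt_pi.2 (hf t ht)
  have hFc : ContinuousOn f (Icc 0 1) := fun t ht => (hF t ht).continuousAt.continuousWithinAt
  -- fencing with boundary `B_δ(t) = m₀ + ∫₀ᵗ G + δ t`
  have key : ∀ δ : ℝ, 0 < δ → δ ≤ (m - (m₀ + I1)) / 2 →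
      ∀ x ∈ Icc (0 : ℝ) 1, ‖f x‖ ≤ m₀ + (∫ s in (0 : ℝ)..x, G s) + δ * x := by
    intro δ hδ hδε
    have hB : ∀ x, HasDerivAt (fun t => m₀ + (∫ s in (0 : ℝ)..t, G s) + δ * t) (G x + δ) x := fun x => by
      have h1 := (hGc.integral_hasStrictDerivAt 0 x).hasDerivAt
      have h2 : HasDerivAt (fun t : ℝ => δ * t) δ x := by simpa using (hasDerivAt_id x).const_mul δ
      exact (h1.const_add m₀).add h2
    refine fun x hx => image_norm_le_of_norm_deriv_right_lt_deriv_boundary hFc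
      (fun x hx => (hF x (Ico_subset_Icc_self hx)).hasDerivWithinAt) ?_ hB ?_ hx
    · simp only [integral_same, mul_zero, add_zero]
      exact (pi_norm_le_iff_of_nonneg hm₀).2 h0
    · intro x hx hfx
      have hx' : x ∈ Icc (0 : ℝ) 1 := Ico_subset_Icc_self hx
      have hBle : m₀ + (∫ s in (0 : ℝ)..x, G s) + δ * x ≤ m := by
        have h1 := hIle x hx'
        nlinarith [hx.1, hx.2.le]
      have hfk : ∀ k, ‖f x k‖ ≤ m := fun k => (norm_le_pi_norm (f x) k).trans (hfx.le.trans hBle)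
      have hr := hrate x hx hfk
      have hgx : 0 ≤ g x := hg0 x hx'
      calc ‖f' x‖ ≤ g x := (pi_norm_le_iff_of_nonneg hgx).2 hr
        _ < G x + δ := by rw [hGg x hx']; linarith
  intro t ht k
  have hmain : ‖f t‖ ≤ m₀ + ∫ s in (0 : ℝ)..t, g s := by
    refine le_of_forall_pos_le_add fun δ hδ => ?_
    have hδ' : 0 < min δ ((m - (m₀ + I1)) / 2) := lt_min hδ (by linarith)
    have h := key _ hδ' (min_le_right _ _) t ht
    rw [hint t ht] at h
    have hmin : min δ ((m - (m₀ + I1)) / 2) * t ≤ δ := by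
      have h1 : min δ ((m - (m₀ + I1)) / 2) * t ≤ min δ ((m - (m₀ + I1)) / 2) * 1 :=
        mul_le_mul_of_nonneg_left ht.2 hδ'.le
      rw [mul_one] at h1
      exact h1.trans (min_le_left _ _)
    linarith
  exact (norm_le_pi_norm (f t) k).trans hmain

/-- … in particular the family stays `≤ m` on the whole slice. -/
theorem kltc_apriori_of_flow_le (f f' : ℝ → κ → ℂ) (g : ℝ → ℝ) {m m₀ : ℝ} (hm₀ : 0 ≤ m₀)
    (hf : ∀ t ∈ Icc (0 : ℝ) 1, ∀ k, HasDerivAt (fun s => f s k) (f' t k) t)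
    (hg : ContinuousOn g (Icc 0 1)) (hg0 : ∀ t ∈ Icc (0 : ℝ) 1, 0 ≤ g t) (h0 : ∀ k, ‖f 0 k‖ ≤ m₀)
    (hrate : ∀ t ∈ Ico (0 : ℝ) 1, (∀ k, ‖f t k‖ ≤ m) → ∀ k, ‖f' t k‖ ≤ g t)
    (hslack : m₀ + ∫ t in (0 : ℝ)..1, g t < m) :
    ∀ t ∈ Icc (0 : ℝ) 1, ∀ k, ‖f t k‖ ≤ m := by
  intro t ht k
  have h := kltc_apriori_of_flow f f' g hm₀ hf hg hg0 h0 hrate hslack t ht k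
  have hsub : uIcc (0 : ℝ) 1 ⊆ Icc 0 1 := by rw [uIcc_of_le zero_le_one]
  have hI : ∫ s in (0 : ℝ)..t, g s ≤ ∫ s in (0 : ℝ)..1, g s :=
    integral_mono_interval le_rfl ht.1 ht.2
      ((ae_restrict_iff' measurableSet_Ioc).2 (ae_of_all _ fun s hs => hg0 s ⟨hs.1.le, hs.2⟩))
      ((hg.mono hsub).intervalIntegrable)
  linarith

end Generic

/-! ## Matrix form -/

section MatrixForm

variable {ι : Type*} [Fintype ι]

/-- **A priori entry bound within the slice for the pair-vertex flow** (the `hΓm` input of `kltc_riccati_duhamel_weighted` /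
`klws_wickStep_of_scaleFlow`): `Γ, Γ̇ : ℝ → Matrix ι ι ℂ` with entrywise `HasDerivAt` on `[0,1]`, start `|Γ(0)| ≤ m₀` (`0 ≤ m₀`), conditional rate
«`|Γ(t)| ≤ m` entrywise ⇒ `|Γ̇(t)(x,y)| ≤ g t`» for `t ∈ [0,1)`, `g ≥ 0` continuous, slack `m₀ + ∫₀¹ g < m` ⇒ `|Γ(t)(x,y)| ≤ m` on `[0,1]`. -/
theorem kltc_apriori_matrix_of_flow (Γ Γ' : ℝ → Matrix ι ι ℂ) (g : ℝ → ℝ) {m m₀ : ℝ} (hm₀ : 0 ≤ m₀)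
    (hΓ : ∀ t ∈ Icc (0 : ℝ) 1, ∀ x y, HasDerivAt (fun s => Γ s x y) (Γ' t x y) t)
    (hg : ContinuousOn g (Icc 0 1)) (hg0 : ∀ t ∈ Icc (0 : ℝ) 1, 0 ≤ g t) (h0 : ∀ x y, ‖Γ 0 x y‖ ≤ m₀)
    (hrate : ∀ t ∈ Ico (0 : ℝ) 1, (∀ x y, ‖Γ t x y‖ ≤ m) → ∀ x y, ‖Γ' t x y‖ ≤ g t)
    (hslack : m₀ + ∫ t in (0 : ℝ)..1, g t < m) :
    ∀ t ∈ Icc (0 : ℝ) 1, ∀ x y, ‖Γ t x y‖ ≤ m := by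
  intro t ht x y
  have h := kltc_apriori_of_flow_le (κ := ι × ι) (fun s p => Γ s p.1 p.2) (fun s p => Γ' s p.1 p.2) g hm₀
    (fun t ht p => hΓ t ht p.1 p.2) hg hg0 (fun p => h0 p.1 p.2)
    (fun t ht hb p => hrate t ht (fun x y => hb (x, y)) p.1 p.2) hslack t ht (x, y)
  exact h

end MatrixForm

end Summit.HubbardSuperconductivity.HubbardSuperconductivity.Theorems.KLRegimeSplit

end
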